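import Literature.NumberTheory.Sieve.PolymathGEHTupleGrid
import Literature.NumberTheory.Sieve.PolymathThetaSumsProofs
import HarnessLib

/-!
# The level of distribution of the truncated inner sequence: the pieces at fixed `x`

Trunk AntSieve, tooling toward the named fact `Literature.NumberTheory.Sieve.weakDHL_three_two_of_GEH`
(D. H. J. Polymath, Res. Math. Sci. 1:12 (2014) = arXiv:1407.4897, Theorem 3.2(xii)).

§4.5, p. 17, the bound (local) `Σ_{q ≲ x^ϑ} sup_a |Δ(1_{[x+h_k,2x+h_k]} λ_{F_k} λ_{G_k} 1_{p(·)>x^ε}; a (q))| ≪ x log^{-A} x`: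
this file carries out, at a fixed large `x`, the decomposition of the windowed sequence
`w_ε 1_{(X₁,X₂]}` (`winSeq`) into the tuple pieces `u_τ = winSeq · [idxList = ofFn τ]` (`pieceSeq`)
over the grid of `PolymathGEHTupleGrid.lean`, and the pointwise comparison of each piece with its
convolution majorant `Conv_τ` (`tupleConv`):

* `winSeq_ne_zero` — integers charged by `winSeq` have all prime factors in `(c_0, c_{J+1}]`, at
  most `R₀ = ⌊1/ε⌋ + 1` of them, and `|winSeq| ≤ 4^{R₀} M²`;
* `winSeq_eq_sum_pieceSeq` — the decomposition;
* `abs_pieceSeq_le` — `|u_τ| ≤ 4^{R₀} M² Conv_τ` (every tuple);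
* `abs_pieceSeq_sub_model_le` — for GOOD tuples (strictly increasing, box inside the window)
  `|u_τ - c_τ Conv_τ| ≤ η Conv_τ` with the model constant `c_τ` ("`λ_{F_k}(n)` is equal to some
  bounded constant … plus an error of `O(log^{-A} x)`", p. 17) and
  `η = 2 · 4^{s+1} M D (s+1) (ρ' - 1)/log x`.

## References

* [Polymath8b2014] D. H. J. Polymath, Res. Math. Sci. 1 (2014), Art. 12 = arXiv:1407.4897,
  §4.5, p. 17.
-/

noncomputable section

open Finset Real
open scoped ArithmeticFunction.omega ArithmeticFunction.Moebius

namespace Literature.NumberTheory.Sieve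

open scoped Classical

/-! ### The windowed sequence and its pieces -/

section Defs

/-- The windowed truncated sequence `w_ε 1_{(X₁, X₂]}`. [cite: Polymath8b2014, §4.5, (local)] -/
def winSeq (F G : ℝ → ℝ) (ε : ℝ) (h₀ : ℤ) (x : ℝ) (n : ℕ) : ℝ :=
  if thetaX1 h₀ x < n ∧ n ≤ thetaX2 h₀ x then wTrunc F G ε x n else 0

/-- The piece of the tuple `τ`: `u_τ = winSeq · [idxList = ofFn τ]`. [cite: Polymath8b2014, §4.5, p. 17] -/
def pieceSeq (F G : ℝ → ℝ) (ε A₀ : ℝ) (h₀ : ℤ) (x : ℝ) {r : ℕ} (τ : Fin r → ℕ) (n : ℕ) : ℝ :=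
  if idxList (gridAt ε A₀ x) (gridJ A₀ x) n = List.ofFn τ then winSeq F G ε h₀ x n else 0

/-- The bottom `∏ c_{τ i}` of the box of `τ`. [folklore] -/
def boxBot (ε A₀ x : ℝ) {r : ℕ} (τ : Fin r → ℕ) : ℕ := ∏ i, gridAt ε A₀ x (τ i)

/-- The top `∏ c_{τ i + 1}` of the box of `τ`. [folklore] -/
def boxTop (ε A₀ x : ℝ) {r : ℕ} (τ : Fin r → ℕ) : ℕ := ∏ i, gridAt ε A₀ x (τ i + 1)

/-- The model logarithms `u_j = log c_{j+1} / log x`. [cite: Polymath8b2014, §4.5, p. 17] -/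
def gridLog (ε A₀ x : ℝ) (j : ℕ) : ℝ := Real.log (gridAt ε A₀ x (j + 1)) / Real.log x

/-- The model constant of a tuple: `c_τ = modelValue F u τ · modelValue G u τ`. [cite: Polymath8b2014, §4.5, p. 17] -/
def tupleModel (F G : ℝ → ℝ) (ε A₀ x : ℝ) {r : ℕ} (τ : Fin r → ℕ) : ℝ :=
  modelValue F (gridLog ε A₀ x) τ * modelValue G (gridLog ε A₀ x) τ

/-- A GOOD tuple: strictly increasing with box inside the window. [cite: Polymath8b2014, §4.5, p. 17] -/
def IsGoodTuple (ε A₀ : ℝ) (h₀ : ℤ) (x : ℝ) {r : ℕ} (τ : Fin r → ℕ) : Prop :=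
  StrictMono τ ∧ thetaX1 h₀ x ≤ boxBot ε A₀ x τ ∧ boxTop ε A₀ x τ ≤ thetaX2 h₀ x

end Defs

/-- A list of naturals all `> z ≥ 0` has product `≥ z^{length}`. [folklore] -/
theorem pow_length_le_prod {z : ℝ} (hz : 0 ≤ z) : ∀ (l : List ℕ), (∀ p ∈ l, z < (p : ℝ)) →
    z ^ l.length ≤ ((l.prod : ℕ) : ℝ)
  | [], _ => by simp
  | p :: l, h => by
    rw [List.length_cons, pow_succ, List.prod_cons, Nat.cast_mul, mul_comm ((p : ℕ) : ℝ)]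
    have hp := h p List.mem_cons_self
    have ih := pow_length_le_prod hz l (fun q hq => h q (List.mem_cons_of_mem _ hq))
    exact mul_le_mul ih hp.le hz (Nat.cast_nonneg _)

/-! ### Facts at a fixed large `x` -/

section Fixed

variable {F G : ℝ → ℝ} {M D ε A₀ x : ℝ} {h₀ : ℤ}

/-- Integers charged by `winSeq`: prime factors in `(c_0, c_{J+1}]` and at most `⌊1/ε⌋ + 1` of them;
`n ≥ 2`; `|winSeq n| ≤ 4^{⌊1/ε⌋+1} M²`. [cite: Polymath8b2014, §4.5, p. 17] -/
theorem winSeq_ne_zero (hMF : ∀ t, |F t| ≤ M) (hMG : ∀ t, |G t| ≤ M) (hε : 0 < ε)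
    (hx4 : 4 ≤ x) (hxε : 3 ≤ x ^ ε) (hxh : (h₀.natAbs : ℝ) + 2 ≤ x) {n : ℕ}
    (hn : winSeq F G ε h₀ x n ≠ 0) :
    2 ≤ n ∧ (∀ p ∈ n.primeFactorsList, gridAt ε A₀ x 0 < p ∧ p ≤ gridAt ε A₀ x (gridJ A₀ x + 1)) ∧
      n.primeFactorsList.length ≤ ⌊1 / ε⌋₊ + 1 ∧
      |winSeq F G ε h₀ x n| ≤ 4 ^ (⌊1 / ε⌋₊ + 1) * M ^ 2 := by
  have hx0 : 0 < x := by linarith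
  have hx1 : 1 < x := by linarith
  have hlog : 0 < Real.log x := Real.log_pos hx1
  have hM0 : 0 ≤ M := (abs_nonneg _).trans (hMF 0)
  obtain ⟨hX₁1, -, hX₂3⟩ := thetaX_sizes h₀ hxh
  -- unfold the window
  have hwin : thetaX1 h₀ x < n ∧ n ≤ thetaX2 h₀ x := by
    by_contra h; exact hn (by rw [winSeq, if_neg h])
  have hw : wTrunc F G ε x n ≠ 0 := by
    intro h; exact hn (by rw [winSeq, if_pos hwin, h])
  have hrough := rough_of_wTrunc_ne_zero hw
  have hn2 : 2 ≤ n := by omega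
  have hn0 : n ≠ 0 := by omega
  have hn3x : (n : ℝ) ≤ 3 * x := le_trans (by exact_mod_cast hwin.2) hX₂3
  -- prime factors
  have hfac : ∀ p ∈ n.primeFactorsList, gridAt ε A₀ x 0 < p ∧ p ≤ gridAt ε A₀ x (gridJ A₀ x + 1) := by
    intro p hp
    have hp' := hrough p hp
    constructor
    · rw [gridAt_zero hxε]
      exact (Nat.floor_lt (by positivity)).2 hp'
    · have hpn : p ≤ n := Nat.le_of_mem_primeFactorsList hp
      have h3 := three_mul_le_gridAt_gridJ (ε := ε) (A₀ := A₀) hε.le hx4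
      have : (p : ℝ) ≤ n := by exact_mod_cast hpn
      exact_mod_cast (show (p : ℝ) ≤ gridAt ε A₀ x (gridJ A₀ x + 1) by linarith)
  -- the number of prime factors: `x^{ε r} ≤ n ≤ 3x`
  have hxε0 : 0 < x ^ ε := by positivity
  have hlen : n.primeFactorsList.length ≤ ⌊1 / ε⌋₊ + 1 := by
    set r := n.primeFactorsList.length with hr
    have hprod : (x ^ ε) ^ r ≤ n := by
      have := pow_length_le_prod hxε0.le n.primeFactorsList hrough
      rwa [Nat.prod_primeFactorsList hn0] at this
    have h1 : (r : ℝ) * (ε * Real.log x) ≤ Real.log 3 + Real.log x := by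
      have h2 : Real.log ((x ^ ε) ^ r) ≤ Real.log (3 * x) :=
        Real.log_le_log (by positivity) (hprod.trans hn3x)
      rwa [Real.log_pow, Real.log_rpow hx0, Real.log_mul (by norm_num) hx0.ne'] at h2
    have h3 : Real.log 3 ≤ ε * Real.log x := by
      have := Real.log_le_log (by norm_num) hxε
      rwa [Real.log_rpow hx0] at this
    have h4 : (r : ℝ) ≤ 1 / ε + 1 := by
      have hεl : 0 < ε * Real.log x := by positivity
      have : (r : ℝ) * (ε * Real.log x) ≤ (1 / ε + 1) * (ε * Real.log x) := by
        have e : (1 / ε + 1) * (ε * Real.log x) = Real.log x + ε * Real.log x := by field_simp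
        rw [e]; linarith
      exact le_of_mul_le_mul_right this hεl
    have h5 : r ≤ ⌊1 / ε + 1⌋₊ := Nat.le_floor h4
    rwa [Nat.floor_add_one (by positivity)] at h5
  refine ⟨hn2, hfac, hlen, ?_⟩
  -- the size
  have hω : ω n ≤ ⌊1 / ε⌋₊ + 1 := by
    rw [ArithmeticFunction.cardDistinctFactors_apply]
    exact ((List.dedup_sublist _).length_le).trans hlen
  rw [winSeq, if_pos hwin, wTrunc]
  have hρ : |roughInd (x ^ ε) n| ≤ 1 := by
    unfold roughInd; split_ifs; all_goals simp
  have hF := abs_divisorSumWeight_le_two_pow hMF x hn0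
  have hG := abs_divisorSumWeight_le_two_pow hMG x hn0
  have h2ω : (2 : ℝ) ^ ω n ≤ 2 ^ (⌊1 / ε⌋₊ + 1) := pow_le_pow_right₀ (by norm_num) hω
  rw [abs_mul, abs_mul]
  calc |divisorSumWeight F x n| * |divisorSumWeight G x n| * |roughInd (x ^ ε) n|
      ≤ (2 ^ ω n * M) * (2 ^ ω n * M) * 1 :=
        mul_le_mul (mul_le_mul hF hG (abs_nonneg _) (by positivity)) hρ (abs_nonneg _) (by positivity)
    _ ≤ (2 ^ (⌊1 / ε⌋₊ + 1) * M) * (2 ^ (⌊1 / ε⌋₊ + 1) * M) * 1 := by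
        refine mul_le_mul_of_nonneg_right (mul_le_mul (mul_le_mul_of_nonneg_right h2ω hM0)
          (mul_le_mul_of_nonneg_right h2ω hM0) (by positivity) (by positivity)) zero_le_one
    _ = 4 ^ (⌊1 / ε⌋₊ + 1) * M ^ 2 := by
        rw [mul_one, show (4 : ℝ) = 2 ^ 2 by norm_num, ← pow_mul, mul_comm 2, pow_mul]; ring

/-- **The decomposition into tuple pieces**: at every `n`,
`winSeq n = Σ_{1 ≤ r ≤ R₀} Σ_{τ ∈ monoTuples r J} pieceSeq τ n`. [cite: Polymath8b2014, §4.5, p. 17] -/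
theorem winSeq_eq_sum_pieceSeq (hMF : ∀ t, |F t| ≤ M) (hMG : ∀ t, |G t| ≤ M) (hε : 0 < ε)
    (hx4 : 4 ≤ x) (hxε : 3 ≤ x ^ ε) (hxh : (h₀.natAbs : ℝ) + 2 ≤ x) (n : ℕ) :
    winSeq F G ε h₀ x n = ∑ r ∈ Icc 1 (⌊1 / ε⌋₊ + 1), ∑ τ ∈ monoTuples r (gridJ A₀ x),
      pieceSeq F G ε A₀ h₀ x τ n := by
  unfold pieceSeq
  by_cases hn : winSeq F G ε h₀ x n = 0
  · rw [hn]
    symm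
    exact Finset.sum_eq_zero fun r _ => Finset.sum_eq_zero fun τ _ => by simp
  · obtain ⟨hn2, hfac, hlen, -⟩ := winSeq_ne_zero (A₀ := A₀) hMF hMG hε hx4 hxε hxh hn
    exact (sum_monoTuples_ite_eq (gridAt_mono ε A₀ x) hn2 hfac hlen _).symm

/-- A non-zero piece value: `n` matches `τ`, lies in its product set and in the window. [folklore] -/
theorem mem_of_pieceSeq_ne_zero (hMF : ∀ t, |F t| ≤ M) (hMG : ∀ t, |G t| ≤ M) (hε : 0 < ε)
    (hx4 : 4 ≤ x) (hxε : 3 ≤ x ^ ε) (hxh : (h₀.natAbs : ℝ) + 2 ≤ x) {r : ℕ} {τ : Fin r → ℕ} {n : ℕ}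
    (hn : pieceSeq F G ε A₀ h₀ x τ n ≠ 0) :
    idxList (gridAt ε A₀ x) (gridJ A₀ x) n = List.ofFn τ ∧
      n ∈ tupleProducts (tuplePieces (gridAt ε A₀ x) τ) ∧
      thetaX1 h₀ x < n ∧ n ≤ thetaX2 h₀ x ∧ winSeq F G ε h₀ x n ≠ 0 := by
  have hidx : idxList (gridAt ε A₀ x) (gridJ A₀ x) n = List.ofFn τ := by
    by_contra h; exact hn (by rw [pieceSeq, if_neg h])
  have hw : winSeq F G ε h₀ x n ≠ 0 := by
    intro h; exact hn (by rw [pieceSeq, if_pos hidx, h])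
  have hwin : thetaX1 h₀ x < n ∧ n ≤ thetaX2 h₀ x := by
    by_contra h; exact hw (by rw [winSeq, if_neg h])
  obtain ⟨hn2, hfac, -, -⟩ := winSeq_ne_zero (A₀ := A₀) hMF hMG hε hx4 hxε hxh hw
  exact ⟨hidx, mem_tupleProducts_of_idxList_eq (gridAt_mono ε A₀ x) (by omega) hfac hidx,
    hwin.1, hwin.2, hw⟩

/-- The piece vanishes beyond `X₂`. [folklore] -/
theorem pieceSeq_eq_zero_of_lt {r : ℕ} (τ : Fin r → ℕ) {n : ℕ} (hn : thetaX2 h₀ x < n) :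
    pieceSeq F G ε A₀ h₀ x τ n = 0 := by
  unfold pieceSeq
  split_ifs with h
  · unfold winSeq
    rw [if_neg (fun h' => absurd h'.2 (not_le.2 hn))]
  · rfl

/-- **The majorant of every piece**: `|u_τ(n)| ≤ 4^{R₀} M² · Conv_τ(n)`. [cite: Polymath8b2014, §4.5, p. 17] -/
theorem abs_pieceSeq_le (hMF : ∀ t, |F t| ≤ M) (hMG : ∀ t, |G t| ≤ M) (hε : 0 < ε)
    (hx4 : 4 ≤ x) (hxε : 3 ≤ x ^ ε) (hxh : (h₀.natAbs : ℝ) + 2 ≤ x) {s : ℕ} (τ : Fin (s + 1) → ℕ) (n : ℕ) :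
    |pieceSeq F G ε A₀ h₀ x τ n| ≤ 4 ^ (⌊1 / ε⌋₊ + 1) * M ^ 2 * tupleConv (gridAt ε A₀ x) τ n := by
  by_cases hn : pieceSeq F G ε A₀ h₀ x τ n = 0
  · rw [hn, abs_zero]
    exact mul_nonneg (by positivity) (tupleConv_nonneg _ τ n)
  · obtain ⟨hidx, hmem, -, -, hw⟩ := mem_of_pieceSeq_ne_zero hMF hMG hε hx4 hxε hxh hn
    obtain ⟨-, -, -, hbound⟩ := winSeq_ne_zero (A₀ := A₀) hMF hMG hε hx4 hxε hxh hw
    have hval : pieceSeq F G ε A₀ h₀ x τ n = winSeq F G ε h₀ x n := by rw [pieceSeq, if_pos hidx]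
    rw [tuplePieces_succ] at hmem
    have h1 := one_le_conv_of_mem_tupleProducts (P := gridPiece (gridAt ε A₀ x) (τ (Fin.last s)))
      (Ps := tuplePieces (gridAt ε A₀ x) fun i : Fin s => τ i.castSucc)
      (by rw [← tuplePieces_succ]; exact prime_of_mem_tuplePieces _ τ) hmem
    rw [hval]
    calc |winSeq F G ε h₀ x n| ≤ 4 ^ (⌊1 / ε⌋₊ + 1) * M ^ 2 * 1 := by rw [mul_one]; exact hbound
      _ ≤ 4 ^ (⌊1 / ε⌋₊ + 1) * M ^ 2 * tupleConv (gridAt ε A₀ x) τ n :=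
          mul_le_mul_of_nonneg_left h1 (by positivity)

/-! ### Good tuples -/

/-- For a strictly increasing tuple the majorant IS the indicator of the product set. [cite: Polymath8b2014, §4.5, p. 17] -/
theorem tupleConv_eq_indicator {c : ℕ → ℕ} (hc : Monotone c) {s : ℕ} {τ : Fin (s + 1) → ℕ}
    (hτ : StrictMono τ) : tupleConv c τ = setIndicatorAF (tupleProducts (tuplePieces c τ)) := by
  rw [tupleConv, tuplePieces_succ]
  exact (setIndicatorAF_tupleProducts_cons (by rw [← tuplePieces_succ]; exact prime_of_mem_tuplePieces c τ)
    (by rw [← tuplePieces_succ]; exact pieces_pairwise_of_strictMono hc hτ)).symm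

/-- Members of the product set of a strictly increasing tuple are square-free with `ω = s + 1`. [folklore] -/
theorem squarefree_of_mem_tupleProducts {c : ℕ → ℕ} {J : ℕ} (hc : Monotone c) {r : ℕ} {τ : Fin r → ℕ}
    (hτ : StrictMono τ) (hτJ : ∀ i, τ i ≤ J) {n : ℕ} (hn : n ∈ tupleProducts (tuplePieces c τ)) :
    Squarefree n ∧ ω n = r ∧ n.primeFactors.card = r := by
  have hn0 : n ≠ 0 := (pos_of_mem_tupleProducts (prime_of_mem_tuplePieces c τ) n hn).ne'
  have hidx := idxList_eq_of_mem_tupleProducts hc hτ hτJ hn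
  have hnodup : n.primeFactorsList.Nodup := by
    have h1 : (idxList c J n).Nodup := by
      rw [hidx, List.nodup_ofFn]; exact hτ.injective
    exact List.Nodup.of_map _ h1
  have hlen : n.primeFactorsList.length = r := by
    have : (idxList c J n).length = r := by rw [hidx, List.length_ofFn]
    rwa [idxList, List.length_map] at this
  refine ⟨(Nat.squarefree_iff_nodup_primeFactorsList hn0).2 hnodup, ?_, ?_⟩
  · rw [ArithmeticFunction.cardDistinctFactors_apply, hnodup.dedup, hlen]
  · rw [Nat.primeFactors, List.card_toFinset, hnodup.dedup, hlen]

/-- **The model constant is a good approximation on a good tuple.**  For `τ : Fin (s+1) → ℕ` good,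
`F, G` differentiable with `|F|, |G| ≤ M` and `|F'|, |G'| ≤ D`:
`|u_τ(n) - c_τ Conv_τ(n)| ≤ η Conv_τ(n)`, `η = 2 · 4^{s+1} M D (s+1) (ρ' - 1)/log x`,
`ρ' = ρ (1 + 2x^{-ε})` ("`λ_{F_k}(n)` is equal to some bounded constant … plus an error of
`O(log^{-A} x)`", p. 17). [cite: Polymath8b2014, §4.5, p. 17] -/
theorem abs_pieceSeq_sub_model_le (hFd : Differentiable ℝ F) (hGd : Differentiable ℝ G)
    (hMF : ∀ t, |F t| ≤ M) (hMG : ∀ t, |G t| ≤ M) (hDF : ∀ t, |deriv F t| ≤ D) (hDG : ∀ t, |deriv G t| ≤ D)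
    (hε : 0 < ε) (hx4 : 4 ≤ x) (hxε : 3 ≤ x ^ ε) (hxh : (h₀.natAbs : ℝ) + 2 ≤ x)
    {s : ℕ} {τ : Fin (s + 1) → ℕ} (hτJ : ∀ i, τ i ≤ gridJ A₀ x) (hgood : IsGoodTuple ε A₀ h₀ x τ) (n : ℕ) :
    |pieceSeq F G ε A₀ h₀ x τ n - tupleModel F G ε A₀ x τ * tupleConv (gridAt ε A₀ x) τ n| ≤
      (2 * 4 ^ (s + 1) * M * D * (s + 1) * ((gridRho A₀ x * (1 + 2 / x ^ ε) - 1) / Real.log x)) *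
        tupleConv (gridAt ε A₀ x) τ n := by
  have hx0 : 0 < x := by linarith
  have hx1 : 1 < x := by linarith
  have hlog : 0 < Real.log x := Real.log_pos hx1
  have hM0 : 0 ≤ M := (abs_nonneg _).trans (hMF 0)
  have hD0 : 0 ≤ D := (abs_nonneg _).trans (hDF 0)
  set c := gridAt ε A₀ x with hcdef
  have hc : Monotone c := gridAt_mono ε A₀ x
  obtain ⟨hτ, hbot, htop⟩ := hgood
  set ρ' : ℝ := gridRho A₀ x * (1 + 2 / x ^ ε) with hρ'
  have hρ'1 : 1 ≤ ρ' := by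
    have h1 := (one_lt_gridRho A₀ x).le
    have h2 : (1 : ℝ) ≤ 1 + 2 / x ^ ε := by
      have := div_nonneg (by norm_num : (0 : ℝ) ≤ 2) (Real.rpow_nonneg hx0.le ε); linarith
    rw [hρ']; nlinarith
  set η₀ : ℝ := (ρ' - 1) / Real.log x with hη₀
  have hη₀0 : 0 ≤ η₀ := div_nonneg (by linarith) hlog.le
  set η : ℝ := 2 * 4 ^ (s + 1) * M * D * (s + 1) * η₀ with hη
  have hη0 : 0 ≤ η := by rw [hη]; positivity
  have hconv := tupleConv_eq_indicator hc hτ (τ := τ)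
  -- case on whether `n` is in the product set
  by_cases hmem : n ∈ tupleProducts (tuplePieces c τ)
  · -- then `Conv n = 1`, `n` in the window, and the piece is `λ_F(n) λ_G(n)`
    have hn0 : n ≠ 0 := (pos_of_mem_tupleProducts (prime_of_mem_tuplePieces c τ) n hmem).ne'
    have hconv1 : tupleConv c τ n = 1 := by
      rw [hconv, setIndicatorAF_apply, if_pos ⟨hmem, hn0⟩]
    have hidx := idxList_eq_of_mem_tupleProducts hc hτ hτJ hmem
    have hlo := prod_lt_of_mem_tupleProducts (c := c) (by omega) hmem
    have hhi := le_prod_of_mem_tupleProducts (c := c) hmem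
    have hwin : thetaX1 h₀ x < n ∧ n ≤ thetaX2 h₀ x :=
      ⟨lt_of_le_of_lt hbot hlo, hhi.trans htop⟩
    -- roughness: prime factors exceed `c_0 = ⌊x^ε⌋`
    have hrough : ∀ p ∈ n.primeFactorsList, x ^ ε < (p : ℝ) := by
      intro p hp
      have hpp := Nat.prime_of_mem_primeFactorsList hp
      obtain ⟨Q, hQ, hpQ⟩ := exists_mem_of_prime_dvd_tupleProducts (prime_of_mem_tuplePieces c τ) hmem hpp
        (Nat.dvd_of_mem_primeFactorsList hp)
      rw [tuplePieces, List.mem_reverse, List.mem_ofFn] at hQ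
      obtain ⟨i, rfl⟩ := hQ
      obtain ⟨hl, -, -⟩ := (mem_gridPiece c).1 hpQ
      have h0 : c 0 ≤ c (τ i) := hc (Nat.zero_le _)
      rw [hcdef, gridAt_zero hxε] at h0
      have : ⌊x ^ ε⌋₊ < p := lt_of_le_of_lt h0 hl
      exact (Nat.floor_lt (Real.rpow_nonneg hx0.le ε)).1 this
    have hval : pieceSeq F G ε A₀ h₀ x τ n = divisorSumWeight F x n * divisorSumWeight G x n := by
      rw [pieceSeq, if_pos hidx, winSeq, if_pos hwin, wTrunc, roughInd_eq_one hrough, mul_one]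
    -- square-free, `ω = s + 1`
    obtain ⟨hsq, hω, hcard⟩ := squarefree_of_mem_tupleProducts hc hτ hτJ hmem
    -- the model logarithms are close
    have hu : ∀ p ∈ n.primeFactors, |Real.log p / Real.log x - gridLog ε A₀ x (gridIndex c (gridJ A₀ x) p)| ≤ η₀ := by
      intro p hp
      have hpf := Nat.mem_primeFactors.1 hp
      obtain ⟨Q, hQ, hpQ⟩ := exists_mem_of_prime_dvd_tupleProducts (prime_of_mem_tuplePieces c τ) hmem hpf.1 hpf.2.1
      rw [tuplePieces, List.mem_reverse, List.mem_ofFn] at hQ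
      obtain ⟨i, rfl⟩ := hQ
      obtain ⟨hl, hu', hpp⟩ := (mem_gridPiece c).1 hpQ
      have hj : gridIndex c (gridJ A₀ x) p = τ i := gridIndex_of_mem_gridPiece hc (hτJ i) hpQ
      rw [hj, gridLog, ← sub_div, abs_div, abs_of_pos hlog, hη₀]
      refine div_le_div_of_nonneg_right ?_ hlog.le
      -- `log c_{j+1} - log ρ' ≤ log c_j < log p ≤ log c_{j+1}`
      have hp0 : (0 : ℝ) < p := by exact_mod_cast hpp.pos
      have hcj0 : (0 : ℝ) < c (τ i) := by
        have h3 := three_le_gridAt ε A₀ x (τ i)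
        exact_mod_cast lt_of_lt_of_le (by norm_num : 0 < 3) h3
      have hpc : (p : ℝ) ≤ c (τ i + 1) := by exact_mod_cast hu'
      have hcp : (c (τ i) : ℝ) < p := by exact_mod_cast hl
      have hcj1 : (0 : ℝ) < c (τ i + 1) := lt_of_lt_of_le hp0 hpc
      have hratio : (c (τ i + 1) : ℝ) ≤ ρ' * c (τ i) := gridAt_succ_le_ratio hx0 hxε (τ i)
      have hρ'0 : 0 < ρ' := by linarith
      have h1 : Real.log p ≤ Real.log (c (τ i + 1)) := Real.log_le_log hp0 hpc
      have h2 : Real.log (c (τ i + 1)) ≤ Real.log ρ' + Real.log (c (τ i)) := by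
        rw [← Real.log_mul hρ'0.ne' hcj0.ne']; exact Real.log_le_log hcj1 hratio
      have h3 : Real.log (c (τ i)) < Real.log p := Real.log_lt_log hcj0 hcp
      have h4 : Real.log ρ' ≤ ρ' - 1 := Real.log_le_sub_one_of_pos hρ'0
      rw [abs_sub_comm, abs_of_nonneg (by linarith)]
      linarith
    -- the two divisor sums against their models
    have hF1 := abs_divisorSumWeight_sub_lambdaModel_le hFd hDF x hsq
      (fun p => gridLog ε A₀ x (gridIndex c (gridJ A₀ x) p)) hu
    have hG1 := abs_divisorSumWeight_sub_lambdaModel_le hGd hDG x hsq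
      (fun p => gridLog ε A₀ x (gridIndex c (gridJ A₀ x) p)) hu
    rw [hcard, lambdaModel_eq_modelValue hc hτ hτJ hmem F (gridLog ε A₀ x)] at hF1
    rw [hcard, lambdaModel_eq_modelValue hc hτ hτJ hmem G (gridLog ε A₀ x)] at hG1
    have hlamG : |divisorSumWeight G x n| ≤ 2 ^ (s + 1) * M := by
      have := abs_divisorSumWeight_le_two_pow hMG x hn0; rwa [hω] at this
    have hLamF : |modelValue F (gridLog ε A₀ x) τ| ≤ 2 ^ (s + 1) * M := abs_modelValue_le hMF _ τ
    rw [hval, hconv1, mul_one, mul_one, tupleModel]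
    set a := divisorSumWeight F x n
    set b := divisorSumWeight G x n
    set A' := modelValue F (gridLog ε A₀ x) τ
    set B' := modelValue G (gridLog ε A₀ x) τ
    have e : a * b - A' * B' = (a - A') * b + A' * (b - B') := by ring
    rw [e]
    have hsr : ((s + 1 : ℕ) : ℝ) = (s : ℝ) + 1 := by push_cast; ring
    rw [hsr] at hF1 hG1
    calc |(a - A') * b + A' * (b - B')| ≤ |a - A'| * |b| + |A'| * |b - B'| := by
          rw [← abs_mul, ← abs_mul]; exact abs_add_le _ _
      _ ≤ (2 ^ (s + 1) * (D * ((s + 1) * η₀))) * (2 ^ (s + 1) * M) +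
            (2 ^ (s + 1) * M) * (2 ^ (s + 1) * (D * ((s + 1) * η₀))) :=
          add_le_add (mul_le_mul hF1 hlamG (abs_nonneg _) (by positivity))
            (mul_le_mul hLamF hG1 (abs_nonneg _) (by positivity))
      _ = η := by
          rw [hη, show (4 : ℝ) ^ (s + 1) = 2 ^ (s + 1) * 2 ^ (s + 1) by rw [← mul_pow]; norm_num]
          ring
  · -- otherwise both sides vanish
    have hconv0 : tupleConv c τ n = 0 := by
      rw [hconv, setIndicatorAF_apply, if_neg (fun h => hmem h.1)]
    have hval : pieceSeq F G ε A₀ h₀ x τ n = 0 := by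
      by_contra hne
      exact hmem (mem_of_pieceSeq_ne_zero hMF hMG hε hx4 hxε hxh hne).2.1
    rw [hval, hconv0, mul_zero, mul_zero, sub_zero, abs_zero]

end Fixed

end Literature.NumberTheory.Sieve
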